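import Mathlib
import Summits.ValiantsHypothesis.ValiantsHypothesis.Theorems.NewtonUnitEquationsNewtonTauWeakK10Defs
import Summits.ValiantsHypothesis.ValiantsHypothesis.Theorems.NewtonUnitEquationsNewtonTauWeakCornerWords

/-!
# `NewtonTauWeak` (stmt-ValiantsHypothesis-5904): Laurent model for the `K = 3` fixed-coincidence rung

Support file (Laurent lemmas; objects in `…K10Defs.lean`) for the siege stub `fixedKCoincidence_t2_K3` of the crux
`Summit.ValiantsHypothesis.ValiantsHypothesis.Theses.NewtonUnitEquations.NewtonTauWeak` (KPTT arXiv:1308.2286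
Conj. 1, weak form; first open rung `K = 3`, `t = 2`, coinciding subset sums, under "no short 2-vs-1 direction
relations", `Cruxes/NewtonTauWeak/Lines/binomial-normal-form-ltc.md`).  The local analysis near a corner of the
Newton polygon is carried out in the Laurent ring `L = ℂ[ℤ²]` (`AddMonoidAlgebra ℂ (Fin 2 → ℤ)`), with the weight
`wt`, words `push`, separated coefficients `sepCoeff`, the box `box` and `OnRay` of the corner model
(`…CornerDefs.lean`).  This file: monomials `T z`, initial exponents `IsInit` (lightest support point for a real
weight), weight-bounded supports, the unit-like product lemma, separated products
`sepProd E P = Π_e P_e(T^{E_e})` of univariate polynomials along directions, and their coefficient EXPANSION over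
words (`coeff_sepProd`), support positivity and low-order congruence.  Everything is routine [folklore].
-/

-- the namespace mandated for this Theorems file repeats the component `ValiantsHypothesis`
set_option linter.dupNamespace false

noncomputable section

open scoped BigOperators Polynomial
open Summit.ValiantsHypothesis.ValiantsHypothesis.Theorems.NewtonTauWeakCorner

namespace Summit.ValiantsHypothesis.ValiantsHypothesis.Theorems.NewtonTauWeakK10

/-! ## The Laurent ring and its monomials -/

/-- `T^a T^b = T^{a+b}`. [folklore] -/
theorem T_mul (a b : Fin 2 → ℤ) : T a * T b = T (a + b) := by
  simp [T, AddMonoidAlgebra.single_mul_single]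

/-- `(T^z)^k = T^{k z}`. [folklore] -/
theorem T_pow (z : Fin 2 → ℤ) (k : ℕ) : T z ^ k = T (k • z) := by
  simp [T, AddMonoidAlgebra.single_pow]

/-- `T^0 = 1`. [folklore] -/
theorem T_zero : T 0 = (1 : L) := by
  simp [T, AddMonoidAlgebra.one_def]

/-- A scalar multiple of a monomial is a `single`. [folklore] -/
theorem smul_T (c : ℂ) (z : Fin 2 → ℤ) : c • T z = AddMonoidAlgebra.single z c := by
  simp [T]

/-- Coefficients of a monomial. [folklore] -/
theorem coeff_T (z y : Fin 2 → ℤ) : (T z).coeff y = if z = y then 1 else 0 := by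
  classical
  simp [T, AddMonoidAlgebra.coeff_single, Finsupp.single_apply]

/-- Multiplication by `T^u` shifts coefficients. [folklore] -/
theorem coeff_T_mul (u : Fin 2 → ℤ) (x : L) (n : Fin 2 → ℤ) : (T u * x).coeff (u + n) = x.coeff n := by
  rw [T, AddMonoidAlgebra.coeff_single_mul_eq_mul_coeff (m₂ := n)]
  · simp
  · intro m _
    exact ⟨fun h => add_left_cancel h, fun h => by rw [h]⟩

/-- Multiplication by `T^u` shifts coefficients (subtractive form). [folklore] -/
theorem coeff_T_mul' (u : Fin 2 → ℤ) (x : L) (z : Fin 2 → ℤ) : (T u * x).coeff z = x.coeff (z - u) := by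
  have := coeff_T_mul u x (z - u)
  rwa [add_sub_cancel] at this

/-! ## Initial exponents for a real weight -/

/-- The initial exponent is unique. [folklore] -/
theorem IsInit.unique {w : Fin 2 → ℝ} {x : L} {v v' : Fin 2 → ℤ} (h : IsInit w x v) (h' : IsInit w x v') :
    v = v' := by
  by_contra hne
  have h1 := h.2 v' h'.1 (Ne.symm hne)
  have h2 := h'.2 v h.1 hne
  exact lt_asymm h1 h2

/-- A point with nonzero coefficient that is weakly lightest is the initial exponent (generic weight). [folklore] -/
theorem isInit_of_forall_le {w : Fin 2 → ℝ} (hgen : Function.Injective (wt w)) {x : L} {v : Fin 2 → ℤ}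
    (hv : x.coeff v ≠ 0) (hle : ∀ z, x.coeff z ≠ 0 → wt w v ≤ wt w z) : IsInit w x v :=
  ⟨hv, fun z hz hne => lt_of_le_of_ne (hle z hz) fun heq => hne (hgen heq).symm⟩

/-- Lighter points have zero coefficient. [folklore] -/
theorem IsInit.coeff_eq_zero_of_lt {w : Fin 2 → ℝ} {x : L} {v : Fin 2 → ℤ} (h : IsInit w x v)
    {z : Fin 2 → ℤ} (hz : wt w z < wt w v) : x.coeff z = 0 := by
  by_contra hne
  have hzv : z ≠ v := fun heq => by rw [heq] at hz; exact lt_irrefl _ hz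
  exact lt_asymm hz (h.2 z hne hzv)

/-- Points of equal or smaller weight other than `v` have zero coefficient. [folklore] -/
theorem IsInit.coeff_eq_zero_of_le {w : Fin 2 → ℝ} {x : L} {v : Fin 2 → ℤ} (h : IsInit w x v)
    {z : Fin 2 → ℤ} (hz : wt w z ≤ wt w v) (hne : z ≠ v) : x.coeff z = 0 := by
  by_contra h0
  exact absurd (h.2 z h0 hne) (not_lt.mpr hz)

/-- Scaling by a nonzero scalar does not move the initial exponent. [folklore] -/
theorem isInit_smul_iff {w : Fin 2 → ℝ} {x : L} {v : Fin 2 → ℤ} {c : ℂ} (hc : c ≠ 0) :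
    IsInit w (c • x) v ↔ IsInit w x v := by
  simp only [IsInit, AddMonoidAlgebra.coeff_smul, Finsupp.smul_apply, smul_eq_mul, ne_eq, mul_eq_zero, hc,
    false_or]

/-- Shifting by `T^u` shifts the initial exponent. [folklore] -/
theorem isInit_T_mul_iff {w : Fin 2 → ℝ} (u : Fin 2 → ℤ) (x : L) (v : Fin 2 → ℤ) :
    IsInit w (T u * x) (u + v) ↔ IsInit w x v := by
  constructor
  · rintro ⟨h1, h2⟩
    refine ⟨by rwa [coeff_T_mul] at h1, fun z hz hne => ?_⟩
    have := h2 (u + z) (by rwa [coeff_T_mul]) (fun h => hne (add_left_cancel h))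
    rw [wt_add, wt_add] at this
    linarith
  · rintro ⟨h1, h2⟩
    refine ⟨by rwa [coeff_T_mul], fun z hz hne => ?_⟩
    have hz' : x.coeff (z - u) ≠ 0 := by rwa [coeff_T_mul'] at hz
    have := h2 (z - u) hz' (fun h => hne (by rw [← h, add_sub_cancel]))
    have e : wt w z = wt w u + wt w (z - u) := by rw [← wt_add, add_sub_cancel]
    rw [wt_add, e]
    linarith

/-! ## Weight-bounded supports -/

/-- Coefficients below the bound vanish. [folklore] -/
theorem LowWt.coeff_eq_zero {w : Fin 2 → ℝ} {x : L} {μ : ℝ} (h : LowWt w x μ) {z : Fin 2 → ℤ}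
    (hz : wt w z < μ) : x.coeff z = 0 := by
  by_contra hne
  exact absurd (h z hne) (not_le.mpr hz)

/-- Weakening the bound. [folklore] -/
theorem LowWt.mono {w : Fin 2 → ℝ} {x : L} {μ ν : ℝ} (h : LowWt w x μ) (hle : ν ≤ μ) : LowWt w x ν :=
  fun z hz => hle.trans (h z hz)

/-- A monomial is bounded below by its weight. [folklore] -/
theorem lowWt_T (w : Fin 2 → ℝ) (z : Fin 2 → ℤ) : LowWt w (T z) (wt w z) := by
  intro y hy
  rw [coeff_T] at hy
  split_ifs at hy with h
  · rw [h]
  · exact absurd rfl hy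

/-- Sums preserve lower weight bounds. [folklore] -/
theorem LowWt.add {w : Fin 2 → ℝ} {x y : L} {μ : ℝ} (hx : LowWt w x μ) (hy : LowWt w y μ) :
    LowWt w (x + y) μ := by
  intro z hz
  rw [AddMonoidAlgebra.coeff_add, Finsupp.add_apply] at hz
  by_cases h : x.coeff z = 0
  · rw [h, zero_add] at hz; exact hy z hz
  · exact hx z h

/-- Differences preserve lower weight bounds. [folklore] -/
theorem LowWt.sub {w : Fin 2 → ℝ} {x y : L} {μ : ℝ} (hx : LowWt w x μ) (hy : LowWt w y μ) :
    LowWt w (x - y) μ := by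
  intro z hz
  rw [AddMonoidAlgebra.coeff_sub, Finsupp.sub_apply] at hz
  by_cases h : x.coeff z = 0
  · rw [h, zero_sub, neg_ne_zero] at hz; exact hy z hz
  · exact hx z h

/-- Scalar multiples preserve lower weight bounds. [folklore] -/
theorem LowWt.smul {w : Fin 2 → ℝ} {x : L} {μ : ℝ} (hx : LowWt w x μ) (c : ℂ) : LowWt w (c • x) μ := by
  intro z hz
  rw [AddMonoidAlgebra.coeff_smul, Finsupp.smul_apply, smul_eq_mul] at hz
  exact hx z (right_ne_zero_of_mul hz)

/-- Finite sums preserve lower weight bounds. [folklore] -/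
theorem lowWt_sum {w : Fin 2 → ℝ} {ι : Type*} (s : Finset ι) (f : ι → L) {μ : ℝ}
    (h : ∀ i ∈ s, LowWt w (f i) μ) : LowWt w (∑ i ∈ s, f i) μ := by
  classical
  induction s using Finset.induction_on with
  | empty => intro z hz; simp at hz
  | insert a s ha ih =>
    rw [Finset.sum_insert ha]
    exact (h a (Finset.mem_insert_self a s)).add (ih fun i hi => h i (Finset.mem_insert_of_mem hi))

/-- A nonzero coefficient of a product comes from a pair of nonzero coefficients. [folklore] -/
theorem exists_of_coeff_mul_ne_zero {x y : L} {z : Fin 2 → ℤ} (h : (x * y).coeff z ≠ 0) :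
    ∃ a b, x.coeff a ≠ 0 ∧ y.coeff b ≠ 0 ∧ a + b = z := by
  classical
  have hz : z ∈ (x * y).coeff.support := Finsupp.mem_support_iff.mpr h
  have := AddMonoidAlgebra.support_coeff_mul_subset x y hz
  obtain ⟨a, ha, b, hb, hab⟩ := Finset.mem_add.mp this
  exact ⟨a, b, Finsupp.mem_support_iff.mp ha, Finsupp.mem_support_iff.mp hb, hab⟩

/-- Products add lower weight bounds. [folklore] -/
theorem LowWt.mul {w : Fin 2 → ℝ} {x y : L} {μ ν : ℝ} (hx : LowWt w x μ) (hy : LowWt w y ν) :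
    LowWt w (x * y) (μ + ν) := by
  intro z hz
  obtain ⟨a, b, ha, hb, rfl⟩ := exists_of_coeff_mul_ne_zero hz
  rw [wt_add]
  exact add_le_add (hx a ha) (hy b hb)

/-- Finite products of nonnegatively weighted factors are nonnegatively weighted. [folklore] -/
theorem lowWt_prod {w : Fin 2 → ℝ} {ι : Type*} (s : Finset ι) (f : ι → L)
    (h : ∀ i ∈ s, LowWt w (f i) 0) : LowWt w (∏ i ∈ s, f i) 0 := by
  classical
  induction s using Finset.induction_on with
  | empty =>
    intro z hz
    rw [Finset.prod_empty, ← T_zero, coeff_T] at hz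
    split_ifs at hz with h0
    · rw [← h0, wt_zero]
    · exact absurd rfl hz
  | insert a s ha ih =>
    rw [Finset.prod_insert ha]
    have := (h a (Finset.mem_insert_self a s)).mul (ih fun i hi => h i (Finset.mem_insert_of_mem hi))
    rwa [add_zero] at this

/-! ## Unit-like factors -/

/-- A unit-like element is nonnegatively weighted. [folklore] -/
theorem UnitLike.lowWt {w : Fin 2 → ℝ} {y : L} (h : UnitLike w y) : LowWt w y 0 := by
  intro z hz
  by_cases h0 : z = 0
  · rw [h0, wt_zero]
  · exact (h.2 z hz h0).le

/-- **Unit-like product lemma.** Multiplying by a unit-like factor keeps the initial exponent and the initial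
coefficient. [folklore] -/
theorem IsInit.mul_unitLike {w : Fin 2 → ℝ} {x y : L} {v : Fin 2 → ℤ} (hx : IsInit w x v) (hy : UnitLike w y) :
    (x * y).coeff v = x.coeff v ∧ IsInit w (x * y) v := by
  classical
  -- the coefficient at `v`: only the pair `(v, 0)` contributes
  have hcoeff : (x * y).coeff v = x.coeff v := by
    rw [AddMonoidAlgebra.coeff_mul]
    rw [Finsupp.sum, Finset.sum_eq_single v]
    · rw [Finsupp.sum, Finset.sum_eq_single 0]
      · simp [hy.1]
      · intro b hb hb0
        rw [if_neg]
        intro h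
        exact hb0 (by simpa using h)
      · intro h0
        exfalso
        exact (Finsupp.mem_support_iff.not.mp h0) (by rw [hy.1]; exact one_ne_zero)
    · intro a ha hav
      rw [Finsupp.sum]
      refine Finset.sum_eq_zero fun b hb => ?_
      rw [if_neg]
      intro hab
      have hb' := Finsupp.mem_support_iff.mp hb
      have ha' := Finsupp.mem_support_iff.mp ha
      -- `a + b = v` with `a ≠ v` forces `b ≠ 0`, `wt b > 0`, so `wt a < wt v`: contradiction
      have hb0 : b ≠ 0 := fun h => hav (by rw [← hab, h, add_zero])
      have h1 := hy.2 b hb' hb0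
      have h2 := hx.2 a ha' hav
      have h3 : wt w v = wt w a + wt w b := by rw [← hab, wt_add]
      linarith
    · intro hv
      exfalso
      exact (Finsupp.mem_support_iff.not.mp hv) hx.1
  refine ⟨hcoeff, ⟨by rw [hcoeff]; exact hx.1, fun z hz hne => ?_⟩⟩
  obtain ⟨a, b, ha, hb, rfl⟩ := exists_of_coeff_mul_ne_zero hz
  by_cases hb0 : b = 0
  · subst hb0
    rw [add_zero] at hne ⊢
    exact hx.2 a ha hne
  · have h1 := hy.2 b hb hb0
    have h2 : wt w v ≤ wt w a := by
      by_cases hav : a = v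
      · rw [hav]
      · exact (hx.2 a ha hav).le
    rw [wt_add]
    linarith

/-! ## Separated products of univariate polynomials along directions -/

/-- Separated products are multiplicative in the univariate data. [folklore] -/
theorem sepProd_mul {s : ℕ} (E : Fin s → Fin 2 → ℤ) (P Q : Fin s → ℂ[X]) :
    sepProd E P * sepProd E Q = sepProd E (P * Q) := by
  unfold sepProd
  rw [← Finset.prod_mul_distrib]
  refine Finset.prod_congr rfl fun e _ => ?_
  rw [Pi.mul_apply, map_mul]

/-- The separated product of the constant family `1` is `1`. [folklore] -/
theorem sepProd_one {s : ℕ} (E : Fin s → Fin 2 → ℤ) : sepProd E (fun _ => (1 : ℂ[X])) = 1 := by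
  unfold sepProd
  simp

/-- Splitting off one direction. [folklore] -/
theorem sepProd_eq_mul_update {s : ℕ} (E : Fin s → Fin 2 → ℤ) (P : Fin s → ℂ[X]) (e₀ : Fin s) :
    sepProd E P = Polynomial.aeval (T (E e₀)) (P e₀) * sepProd E (Function.update P e₀ 1) := by
  classical
  unfold sepProd
  rw [← Finset.mul_prod_erase Finset.univ _ (Finset.mem_univ e₀),
    ← Finset.mul_prod_erase Finset.univ (fun e => Polynomial.aeval (T (E e)) (Function.update P e₀ 1 e))
      (Finset.mem_univ e₀)]
  rw [Function.update_self, map_one, one_mul]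
  congr 1
  refine Finset.prod_congr rfl fun e he => ?_
  rw [Function.update_of_ne (Finset.ne_of_mem_erase he)]

/-- A univariate polynomial along a direction, expanded over a range beyond its degree. [folklore] -/
theorem aeval_T_eq_sum {D : ℕ} (z : Fin 2 → ℤ) (P : ℂ[X]) (hP : P.natDegree ≤ D) :
    Polynomial.aeval (T z) P = ∑ i ∈ Finset.range (D + 1), AddMonoidAlgebra.single ((i : ℕ) • z) (P.coeff i) := by
  rw [Polynomial.aeval_eq_sum_range' (Nat.lt_succ_of_le hP)]
  refine Finset.sum_congr rfl fun i _ => ?_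
  rw [T_pow, smul_T]

/-- **Expansion of a separated product over words.** With all degrees `≤ D`,
`Π_e P_e(T^{E_e}) = Σ_{n ∈ box} sepCoeff P n · T^{push E n}`. [folklore] -/
theorem sepProd_eq_sum {s D : ℕ} (E : Fin s → Fin 2 → ℤ) (P : Fin s → ℂ[X]) (hP : ∀ e, (P e).natDegree ≤ D) :
    sepProd E P = ∑ n ∈ box s D, AddMonoidAlgebra.single (push E n) (sepCoeff P n) := by
  classical
  unfold sepProd
  have : (fun e => Polynomial.aeval (T (E e)) (P e)) =
      fun e => ∑ i ∈ Finset.range (D + 1), AddMonoidAlgebra.single ((i : ℕ) • E e) ((P e).coeff i) := by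
    funext e; exact aeval_T_eq_sum (E e) (P e) (hP e)
  rw [this, Finset.prod_univ_sum]
  refine Finset.sum_congr rfl fun n _ => ?_
  rw [AddMonoidAlgebra.prod_single]
  rfl

/-- **Coefficients of a separated product**: the fibre sum of the separated coefficients over the words of the
box pushing to the point. [folklore] -/
theorem coeff_sepProd {s D : ℕ} (E : Fin s → Fin 2 → ℤ) (P : Fin s → ℂ[X]) (hP : ∀ e, (P e).natDegree ≤ D)
    (z : Fin 2 → ℤ) :
    (sepProd E P).coeff z = ∑ n ∈ box s D, if push E n = z then sepCoeff P n else 0 := by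
  classical
  rw [sepProd_eq_sum E P hP, AddMonoidAlgebra.coeff_sum, Finsupp.finsetSum_apply]
  refine Finset.sum_congr rfl fun n _ => ?_
  rw [AddMonoidAlgebra.coeff_single, Finsupp.single_apply]

/-- A nonzero coefficient of a separated product is witnessed by a contributing word of the box. [folklore] -/
theorem exists_word_of_coeff_sepProd_ne_zero {s D : ℕ} (E : Fin s → Fin 2 → ℤ) (P : Fin s → ℂ[X])
    (hP : ∀ e, (P e).natDegree ≤ D) {z : Fin 2 → ℤ} (hz : (sepProd E P).coeff z ≠ 0) :
    ∃ n ∈ box s D, push E n = z ∧ sepCoeff P n ≠ 0 := by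
  classical
  rw [coeff_sepProd E P hP] at hz
  obtain ⟨n, hn, hne⟩ := Finset.exists_ne_zero_of_sum_ne_zero hz
  refine ⟨n, hn, ?_, ?_⟩
  · by_contra h; rw [if_neg h] at hne; exact hne rfl
  · intro h; rw [h] at hne; simp at hne

/-- The weight of a pushed word is nonnegative for positively weighted directions, and vanishes only for the
empty word. [folklore] -/
theorem wt_push_nonneg {s : ℕ} (E : Fin s → Fin 2 → ℤ) (w : Fin 2 → ℝ) (hw : ∀ e, 0 < wt w (E e))
    (n : Fin s → ℕ) : 0 ≤ wt w (push E n) ∧ (wt w (push E n) = 0 → n = 0) := by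
  rw [wt_push]
  have hnn : ∀ e ∈ (Finset.univ : Finset (Fin s)), 0 ≤ (n e : ℝ) * wt w (E e) :=
    fun e _ => mul_nonneg (Nat.cast_nonneg _) (hw e).le
  refine ⟨Finset.sum_nonneg hnn, fun h0 => ?_⟩
  have hall := (Finset.sum_eq_zero_iff_of_nonneg hnn).mp h0
  funext e
  have := hall e (Finset.mem_univ e)
  rcases mul_eq_zero.mp this with h | h
  · exact_mod_cast h
  · exact absurd h (hw e).ne'

/-- The separated coefficient of the empty word is `1` when all constant coefficients are `1`. [folklore] -/
theorem sepCoeff_zero {s : ℕ} (P : Fin s → ℂ[X]) (hP0 : ∀ e, (P e).coeff 0 = 1) : sepCoeff P 0 = 1 := by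
  unfold sepCoeff
  exact Finset.prod_eq_one fun e _ => by simp [hP0]

/-- **A separated product with constant coefficients `1` is unit-like** (positively weighted directions).
[folklore] -/
theorem k10_unitLike_sepProd {s : ℕ} (E : Fin s → Fin 2 → ℤ) (w : Fin 2 → ℝ) (hw : ∀ e, 0 < wt w (E e))
    (P : Fin s → ℂ[X]) (hP0 : ∀ e, (P e).coeff 0 = 1) : UnitLike w (sepProd E P) := by
  classical
  set D := Finset.univ.sup fun e => (P e).natDegree with hD
  have hP : ∀ e, (P e).natDegree ≤ D := fun e => Finset.le_sup (f := fun e => (P e).natDegree) (Finset.mem_univ e)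
  constructor
  · rw [coeff_sepProd E P hP, Finset.sum_eq_single_of_mem (0 : Fin s → ℕ)]
    · rw [if_pos (push_zero E), sepCoeff_zero P hP0]
    · simp [box]
    · intro n _ hn0
      rw [if_neg]
      intro hpush
      have := (wt_push_nonneg E w hw n).2 (by rw [hpush, wt_zero])
      exact hn0 this
  · intro z hz hz0
    obtain ⟨n, _, hpush, _⟩ := exists_word_of_coeff_sepProd_ne_zero E P hP hz
    rw [← hpush]
    have h := wt_push_nonneg E w hw n
    refine lt_of_le_of_ne h.1 fun h0 => hz0 ?_
    rw [← hpush, h.2 h0.symm, push_zero]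

/-- A single univariate factor along a positively weighted direction is unit-like when its constant
coefficient is `1`. [folklore] -/
theorem unitLike_aeval {w : Fin 2 → ℝ} {Ez : Fin 2 → ℤ} (hEz : 0 < wt w Ez) (P : ℂ[X]) (hP0 : P.coeff 0 = 1) :
    UnitLike w (Polynomial.aeval (T Ez) P) := by
  have h := k10_unitLike_sepProd (fun _ : Fin 1 => Ez) w (fun _ => hEz) (fun _ => P) (fun _ => hP0)
  unfold sepProd at h
  simpa using h

end Summit.ValiantsHypothesis.ValiantsHypothesis.Theorems.NewtonTauWeakK10

end
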